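import Summits.QuantumFields.BalabanUV.T4Continuum.Support.B13Readings
import Literature.Analysis.FunctionSpaces.TorusSobolevNormHolderProofs

/-!
# B13ReadingsInterpolate — row O4-r READINGS, complement: the TOWER readings of design RULE R2 SURVIVE row O1-b's
# weighted-entry norm at a FRACTIONAL PRICE (decay `sδ₀`, rate `θ^{(1−s)k}`), needing only the two runs' ONE-RUN decay

Cell `pub-balaban`, unit `b2b-balaban-t4-ne5-formalise-leaf-07` (NE5 formalisation swarm, LEAF PROVER 07; row **O4-r READINGS** of
`t4/b2b-balaban-t4-ne5-p1/O1-CLAIM-TABLE-NE5-P1.md`, sibling of `Support/B13Readings` p208161).  KERNEL SUGGESTION (iv) of the XREAD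
certificate C-ne5leaf09-3 on `Support/B13OpDatum` (leaf-09, journal l.5748) — credited and implemented.  Summits-side NEW WORK
(bookkeeping; print cited for KIND only).  HONEST FRAMING: rung (B)+1 of the FINITE-VOLUME T⁴ continuum programme — NOT infinite
volume, NOT a mass gap, NOT the Clay problem, NOT a proof of NE5.  HONEST DEPENDENCY (cell, verbatim): continuum YM on T⁴ ⇐
BetaPertH ∧ nine spine estimates (0/9 proved); BetaPertH ⇐ (D1) ∧ (D4) ∧ CAP+tail; G-an2-4 gates asym, D1 and NE2/3/4.

THE POINT.  `B13OpDatum.norm_assemble_sub_le_of_uniform` packages a UNIFORM two-run entry bound `m` (what row NE2's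
operator-norm tower increment `‖avgTow (k+1) − avgTow k‖ ≤ Cop·θ^k` gives entry by entry, `B13Readings.norm_entry_le_l2_opNorm`)
into a decaying-weight format only with the loss `1 ∕ min wt` (tight: leaf-09's `neg_uniform_loss`).  But the two runs' kernels
ALSO obey ONE-RUN decaying format bounds `|K e|, |K′ e| ≤ R·wt e` (B13 (1.7) p. 3 ∕ (2.16) p. 16 KIND — displayed binders, c4),
so `|K e − K′ e| ≤ min (m, 2R·wt e) ≤ m^{1−s}(2R)^s·(wt e)^s` for every `s ∈ [0, 1]` (the tree's real interpolation
`Literature.Analysis.FunctionSpaces.Torus.le_rpow_one_sub_mul_rpow_of_le_of_le` BY NAME; `norm_sub_le_interpolate`): in the format `rpowFormat F s` (weights `(wt e)^s`, i.e. decay `sδ₀` for `wt = e^{−δ₀d}`) the assembled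
data differ by `≤ m^{1−s}(2R)^s` (`norm_assemble_sub_le_interpolate`), and `(Cop·θ^k)^{1−s} = Cop^{1−s}(θ^{1−s})^k`
(`rpow_rate_split`) is a geometric rate `θ^{1−s}` — `s = ½`: decay `½δ₀`, rate `θ^{k∕2}`.  `towerEntry_rate_interpolate` is the
`SpeciesEntryBound`-type conjunct for a species typed AS `avgTow` entries at an embedding, in the decaying format, from
`OutputRateTowerSocket.TowerLaw` + `TowerContracting` BY NAME plus the two levels' one-run format bounds.  NO position-space decay
of the DIFFERENCE (an NE2⁺ estimate the tree does not have at a background) is used.  So route P2's decaying calibration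
(`Calibrated`, rate `sδ₀`) and row NE2's operator-norm tower socket are COMPATIBLE, at the price `(s, 1 − s)`; which `s` an
instantiation takes is the owner's ∕ O6-n's arithmetic (the smallness `ω + Λc < θ′` is read at the rate `θ^{1−s}`).
0 sorry; every theorem is real bookkeeping (`Real.rpow` algebra) or a composition of landed theorems BY NAME; nothing of the
manuscripts is asserted.
-/

noncomputable section

open scoped BigOperators ENNReal Matrix Matrix.Norms.L2Operator

namespace Summit.QuantumFields.BalabanUV.T4Continuum.B13ReadingsInterpolate

open Summit.QuantumFields.BalabanUV.T4Continuum.B13OpDatum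
open Summit.QuantumFields.BalabanUV.T4Continuum.B13Readings (norm_entry_le_l2_opNorm)
open Literature.Analysis.FunctionSpaces.Torus (le_rpow_one_sub_mul_rpow_of_le_of_le)
open Summit.QuantumFields.BalabanUV.T4Continuum.CovariantAveragingTower (avgTow)
open Summit.QuantumFields.BalabanUV.T4Continuum.OutputRateTowerSocket (TowerContracting TowerLaw
  norm_avgTow_succ_sub_le_of_towerLaw)

/-! ## §1 Interpolation of a uniform two-run bound with the one-run decaying format bounds; §2 the tower reading in a
decaying format -/

section Interpolate

variable {E : Type*}

/-- The format with weights raised to the power `s` (for `wt = e^{−δ d}`: decay rate `sδ`). [folklore] -/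
def rpowFormat (F : Format E) (s : ℝ) : Format E :=
  ⟨fun e => F.wt e ^ s, fun e => Real.rpow_pos_of_pos (F.wt_pos e) s⟩

/-- [folklore] The weights of `rpowFormat F s`. -/
@[simp] theorem rpowFormat_wt (F : Format E) (s : ℝ) (e : E) : (rpowFormat F s).wt e = F.wt e ^ s := rfl

/-- [folklore] **ENTRYWISE INTERPOLATION**: two kernels each in the format ball of radius `R` (ONE-RUN bounds, (1.7)-KIND,
displayed) whose difference is UNIFORMLY at most `m` (what an operator-norm tower increment gives) differ, entry by entry, by at
most `m^{1−s}(2R)^s·(wt e)^s` — a bound in the format `rpowFormat F s` (decay `sδ` for `wt = e^{−δd}`). -/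
theorem norm_sub_le_interpolate {F : Format E} {K K' : E → ℂ} {R m s : ℝ} (hK : InFormat F K R) (hK' : InFormat F K' R)
    (hm : ∀ e, ‖K e - K' e‖ ≤ m) (hs0 : 0 ≤ s) (hs1 : s ≤ 1) (e : E) :
    ‖K e - K' e‖ ≤ m ^ (1 - s) * (2 * R) ^ s * (rpowFormat F s).wt e := by
  have hw := F.wt_pos e
  have h2 : ‖K e - K' e‖ ≤ 2 * R * F.wt e :=
    calc ‖K e - K' e‖ ≤ ‖K e‖ + ‖K' e‖ := norm_sub_le _ _
      _ ≤ R * F.wt e + R * F.wt e := add_le_add (hK e) (hK' e)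
      _ = 2 * R * F.wt e := by ring
  have hR2 : 0 ≤ 2 * R := le_of_mul_le_mul_right (by rw [zero_mul]; exact (norm_nonneg _).trans h2) hw
  calc ‖K e - K' e‖ ≤ m ^ (1 - s) * (2 * R * F.wt e) ^ s := le_rpow_one_sub_mul_rpow_of_le_of_le (norm_nonneg _) (hm e) h2 hs0 hs1
    _ = m ^ (1 - s) * (2 * R) ^ s * (rpowFormat F s).wt e := by
        rw [rpowFormat_wt, Real.mul_rpow hR2 hw.le, mul_assoc]

/-- [folklore] A one-run format bound passes to the `s`-power format when the weights are at most `1` (decaying weights)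
and `s ≤ 1`: `wt e ≤ (wt e)^s`. -/
theorem inFormat_rpowFormat {F : Format E} {K : E → ℂ} {R s : ℝ} (hK : InFormat F K R) (hR : 0 ≤ R)
    (hwt : ∀ e, F.wt e ≤ 1) (hs1 : s ≤ 1) : InFormat (rpowFormat F s) K R := fun e =>
  (hK e).trans (mul_le_mul_of_nonneg_left
    (by rw [rpowFormat_wt]
        exact (Real.rpow_one (F.wt e)).symm.le.trans (Real.rpow_le_rpow_of_exponent_ge (F.wt_pos e) (hwt e) hs1)) hR)

/-- [folklore] **THE TOWER READINGS SURVIVE THE WEIGHTED NORM AT FRACTIONAL PRICE** (design R2 reconciled with row O1-b's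
typing): two raw kernels with one-run format bounds of radius `R` (weights `≤ 1`) and a UNIFORM two-run entry bound `m` are
assembled, in the format `rpowFormat F s` (`s ∈ [0,1]`), into data at distance `≤ m^{1−s}(2R)^s`.  With `m = Cop·θ^k` (tower
increment) and `wt = e^{−δ₀d}` this is decay `sδ₀` and rate `θ^{(1−s)k}` (`s = ½`: `½δ₀`, `θ^{k∕2}`) — NO position-space decay of
the DIFFERENCE is needed, only the two runs' ONE-RUN decay (displayed, (1.7)∕(2.16)-KIND). -/
theorem norm_assemble_sub_le_interpolate {F : Format E} {K K' : E → ℂ} {R m s : ℝ} (hK : InFormat F K R)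
    (hK' : InFormat F K' R) (hm : ∀ e, ‖K e - K' e‖ ≤ m) (hm0 : 0 ≤ m) (hR : 0 ≤ R) (hwt : ∀ e, F.wt e ≤ 1)
    (hs0 : 0 ≤ s) (hs1 : s ≤ 1) :
    ‖assemble (rpowFormat F s) K - assemble (rpowFormat F s) K'‖ ≤ m ^ (1 - s) * (2 * R) ^ s :=
  norm_assemble_sub_le (inFormat_rpowFormat hK hR hwt hs1).formatBounded (inFormat_rpowFormat hK' hR hwt hs1).formatBounded
    (mul_nonneg (Real.rpow_nonneg hm0 _) (Real.rpow_nonneg (by linarith) _)) (norm_sub_le_interpolate hK hK' hm hs0 hs1)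

/-- [folklore] Rate bookkeeping: `(Cop·θ^k)^{1−s} = Cop^{1−s}·(θ^{1−s})^k` for `Cop, θ ≥ 0` — the interpolated bound is a
geometric rate `θ^{1−s}`. -/
theorem rpow_rate_split {Cop θ s : ℝ} (hCop : 0 ≤ Cop) (hθ : 0 ≤ θ) (k : ℕ) :
    (Cop * θ ^ k) ^ (1 - s) = Cop ^ (1 - s) * (θ ^ (1 - s)) ^ k := by
  rw [Real.mul_rpow hCop (pow_nonneg hθ k), ← Real.rpow_natCast θ k, ← Real.rpow_mul hθ, mul_comm (k : ℝ) (1 - s),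
    Real.rpow_mul_natCast hθ]

variable {J : Type*} {ιt : J → ℕ → Type*} [∀ j k, Fintype (ιt j k)] [∀ j k, DecidableEq (ιt j k)]

/-- [folklore] **THE TOWER READING IN A DECAYING FORMAT** (the `SpeciesEntryBound`-type conjunct for a species typed AS the
entries of `avgTow` at an embedding `σ`, in the format `rpowFormat F s`): row NE2's law for the family (`TowerLaw` +
`TowerContracting` BY NAME) and the two levels' ONE-RUN format bounds of radius `R` (displayed) give, entry by entry,
`‖avgTow k − avgTow (k+1)‖(σ a′, σ a″) ≤ (Cop·θ^k)^{1−s}(2R)^s·(wt)^s`. -/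
theorem towerEntry_rate_interpolate {A : (j : J) → (k : ℕ) → Matrix (ιt j k) (ιt j (k + 1)) ℂ}
    {X : (j : J) → (k : ℕ) → Matrix (ιt j k) (ιt j k) ℂ} {r Cop θ R s : ℝ} (hr : 0 < r) (hA : TowerContracting A r)
    (hlaw : TowerLaw A X r Cop θ) {κ : Type*} (j : J) (σ : κ → ιt j 0) (F : Format (κ × κ)) (k : ℕ)
    (hRk : InFormat F (fun e => avgTow (A j) r (X j) k (σ e.1) (σ e.2)) R)
    (hRk1 : InFormat F (fun e => avgTow (A j) r (X j) (k + 1) (σ e.1) (σ e.2)) R) (hs0 : 0 ≤ s) (hs1 : s ≤ 1)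
    (a' a'' : κ) :
    ‖avgTow (A j) r (X j) k (σ a') (σ a'') - avgTow (A j) r (X j) (k + 1) (σ a') (σ a'')‖ ≤
      (Cop * θ ^ k) ^ (1 - s) * (2 * R) ^ s * F.wt (a', a'') ^ s := by
  have hm : ∀ e : κ × κ, ‖avgTow (A j) r (X j) k (σ e.1) (σ e.2) - avgTow (A j) r (X j) (k + 1) (σ e.1) (σ e.2)‖ ≤
      Cop * θ ^ k := fun e => by
    rw [norm_sub_rev]
    calc _ = ‖(avgTow (A j) r (X j) (k + 1) - avgTow (A j) r (X j) k) (σ e.1) (σ e.2)‖ := by rw [Matrix.sub_apply]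
      _ ≤ ‖avgTow (A j) r (X j) (k + 1) - avgTow (A j) r (X j) k‖ := norm_entry_le_l2_opNorm _ _ _
      _ ≤ Cop * θ ^ k := norm_avgTow_succ_sub_le_of_towerLaw hr hA hlaw j k
  simpa only [rpowFormat_wt] using norm_sub_le_interpolate hRk hRk1 hm hs0 hs1 (a', a'')

end Interpolate

end Summit.QuantumFields.BalabanUV.T4Continuum.B13ReadingsInterpolate
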